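import Literature.AnabelianGeometry.SemiGraphs.ArithLevelData
import Literature.AnabelianGeometry.SemiGraphs.ArithVertGpStabilizer
import Literature.AnabelianGeometry.SemiGraphs.ArithEdgeStabilizer
import HarnessLib

/-!
# [SemiAnbd] Thm 5.4 packaging: the arithmetic level data of the chart-produced decomposition data,
# ASSEMBLED from the tower (`ArithLevelData.ofChartTreeData`)

Mochizuki, *Semi-graphs of anabelioids*, Publ. RIMS **42** (2006), §5 pp. 62–66 (Def 5.1 (i),
Prop 5.2 (iv), p. 65, Thm 5.4), kurims `paper:url-f33ace170ff4`; the proof of Thm 5.4 (i) p. 66 is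
"entirely similar to … Theorem 3.7 (iii)" (p. 41, with the author's Comments (6)): `Π^temp_𝔊` acts on the
universal graph-coverings `T_j` of the finite levels, and the decomposition groups are read off as
stabilisers of compatible systems of vertices / edges. [cite: MochizukiSemiAnbd2006, Thm 5.4 (i), p. 66]

PACKAGING CONSTRUCTOR of sub-DAG `plan/L3/SUBDAG-SemiAnbd-Thm54.md`, producer row T54-B (GAP-LEDGER
G-w4d053-1), abc-iut-w4-d053 (L3-lead rulings α9-1 / α11-2: "file `ArithLevelData.ofChartTreeData` now
with `hEnds` as an honest binder").  For the PRODUCED decomposition data `decompositionDataOfChart R ι`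
(ArithDecompositionData.lean: the commensurator decomposition groups of p. 65 over the tempered chart
`c`), it builds an inhabitant of the hypothesis package

  `ArithLevelData 𝒢.graph (decompositionDataOfChart R ι) aug baseAct`

(ArithLevelData.lean; consumed by `ArithLevelData.arithMaximalCompactStatementI_of` / `…II_of`,
ArithLevelDataThm54.lean, and by the umbrella `arithMaximalCompactStatementI_and_II_ofChart`,
ArithThm54OfChart.lean) from:

* STRUCTURAL tower data with ARITHMETIC actions (abc-iut-L3-d4's T54-B-tower outputs (O1)–(O3):
  trees `tree j` with `act j : Π^temp_𝔊 →* Aut (tree j)` (open kernels) COVERING `baseAct ∘ aug`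
  (`act_proj`), functorial equivariant transitions `trans`, finite levels `level j` with the
  graph-coverings `quot j` (immersions), `levelAct`, `levelTrans`);
* the GEOMETRIC two-sided vertex dictionary for the restricted action `n ↦ act j (ι n)` (`hfixN`,
  `hstabN`, `huniqN` — (I1)/(I2) of the chart's level data, abc-iut-L3-t8/t6 lineage), from which the
  fields (AI1)/(AI2) `fix` / `stab` are DERIVED by abc-iut-w4-d059's `fix_decompositionDataOfChart` /
  `stab_decompositionDataOfChart` (ArithVertGpStabilizer.lean, p415133);
* the GEOMETRIC pair dictionary (`Adj`, `hAdj`, `hAdjEnds`, `hEndsAdj`, `hEstabN`, `hErigid`, `hEinj`,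
  reference pro-vertices / pro-branches `X`, `Y` with `hX`, `hY`, and `hEtrans` = transitivity of
  `Π^temp_𝔾` on the pro-branches over each branch), from which the fields (AI3) `edge` / `edgeFix` are
  DERIVED by abc-iut-w4-d059's `edge_decompositionDataOfChart_of_ends` / `edgeFix_decompositionDataOfChart`
  (ArithEdgeStabilizer.lean, p417279) — several of these inputs are themselves discharged from level data
  and total estrangement in `ArithEdgeStabilizerInputs.lean` (p418545), consumers plug those in;
* ONE honest combinatorial binder `hEnds` (an eventual compatible system of tree edges carries compatible
  end-point data: two compatible vertex systems and the two branch systems), abc-iut-w4-d059's next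
  deliverable;
* the printed frame hypothesis `noSwitchBase` (Thm 5.4: "the arithmetic actions on the underlying graphs
  … do not switch the branches of any edge") and the field (AI4′) `stabBranchPair` as BINDERS (the
  latter's production — Remark 2.2.1 at branch level for `Π^temp_𝔊` — is open producer debt, see the
  GAP-LEDGER D-row of 2026-08-26T02:12:38Z).

So the signature below IS the residual list of T54-B for the `ArithLevelData` half, in tower currency.
The projections `ofChartTreeData_act` etc. are `rfl` (the tree data are reused verbatim), so that
`ArithLevelData.finite_image_fixes_quotient_ker` (ImmersionLiftUnique.lean) and
`ProfiniteSemiGraph.isCompact_arithVertGp_of_forall_fixes` (TemperedClosedSubgroupCompact.lean) apply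
to the SAME actions.  A DEFINITION assembling binders: nothing is asserted; typed ≠ proved; no side taken
on [IUTchIII] Cor 3.12.
-/

namespace Literature.AnabelianGeometry.SemiGraphs

open CategoryTheory

universe v u u' u''

namespace ProfiniteSemiGraph

variable {𝒢 : ProfiniteSemiGraph.{u}} {c : TemperedPiChart 𝒢} {Gtp : Type u'} [Group Gtp]
  [TopologicalSpace Gtp] {PA : Type u''} [Group PA]

/-- **The arithmetic level data of the chart-produced decomposition data, assembled from the tower**
([SemiAnbd] Thm 5.4 (i) p. 66 / p. 65; packaging constructor of producer row T54-B): structural tree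
data with arithmetic actions + the geometric vertex/pair dictionaries ⇒ an inhabitant of
`ArithLevelData 𝒢.graph (decompositionDataOfChart R ι) aug baseAct`, with (AI1)/(AI2) `fix`/`stab` and
(AI3) `edge`/`edgeFix` DERIVED (abc-iut-w4-d059's dictionaries) and `hEnds`, `noSwitchBase`,
`stabBranchPair` honest binders.  Nothing asserted. [cite: MochizukiSemiAnbd2006, Thm 5.4 (i), p. 66] -/
noncomputable def _root_.Literature.AnabelianGeometry.SemiGraphs.ArithLevelData.ofChartTreeData (h𝒢 : 𝒢.Thm37Hypotheses) (hG : 𝒢.graph.IsGraph)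
    (R : ProfiniteSemiGraph.ChartRepresentatives c)
    (ι : c.G →* Gtp) (hι : Function.Injective ι) (hnorm : (ι.range).Normal)
    (aug : Gtp →* PA) (baseAct : PA →* Aut 𝒢.graph)
    -- structural tree data with ARITHMETIC actions (abc-iut-L3-d4's (O1)–(O3) outputs)
    {J : Type v} [Preorder J] [IsDirectedOrder J] [Nonempty J]
    (tree : J → SemiGraph.{u}) (isTree : ∀ j, (tree j).IsTree) (vertex : ∀ j, (tree j).Vertex)
    (proj : ∀ j, tree j ⟶ 𝒢.graph) (act : ∀ j, Gtp →* Aut (tree j))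
    (isOpen_ker : ∀ j, IsOpen ((act j).ker : Set Gtp))
    (act_proj : ∀ (j : J) (g : Gtp), (act j g).hom ≫ proj j = proj j ≫ (baseAct (aug g)).hom)
    (noSwitchBase : NoBranchSwitching 𝒢.graph.edgeOf
      (fun (a : PA) (b : 𝒢.graph.Branch) => (baseAct a).hom.branchMap b))
    (trans : ∀ ⦃i j : J⦄, i ≤ j → (tree j ⟶ tree i))
    (trans_id : ∀ j, trans (le_refl j) = 𝟙 (tree j))
    (trans_comp : ∀ ⦃i j k : J⦄ (hij : i ≤ j) (hjk : j ≤ k), trans hjk ≫ trans hij = trans (hij.trans hjk))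
    (trans_over : ∀ ⦃i j : J⦄ (h : i ≤ j), trans h ≫ proj i = proj j)
    (trans_act : ∀ ⦃i j : J⦄ (h : i ≤ j) (g : Gtp), (act j g).hom ≫ trans h = trans h ≫ (act i g).hom)
    -- the GEOMETRIC two-sided vertex dictionary for the restricted action (abc-iut-w4-d059's inputs)
    (hfixN : ∀ (v : 𝒢.graph.Vertex) (H : Subgroup c.G), H ∈ ProfiniteSemiGraph.verticialSubgroups c v →
      ∃ x : ∀ j, (tree j).Vertex, (∀ ⦃i j : J⦄ (h : i ≤ j), (trans h).vertexMap (x j) = x i) ∧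
        ∀ n : c.G, n ∈ H ↔ ∀ j, (act j (ι n)).hom.vertexMap (x j) = x j)
    (hstabN : ∀ x : ∀ j, (tree j).Vertex, (∀ ⦃i j : J⦄ (h : i ≤ j), (trans h).vertexMap (x j) = x i) →
      ∃ (v : 𝒢.graph.Vertex) (H : Subgroup c.G), H ∈ ProfiniteSemiGraph.verticialSubgroups c v ∧
        ∀ n : c.G, n ∈ H ↔ ∀ j, (act j (ι n)).hom.vertexMap (x j) = x j)
    (huniqN : ∀ (v : 𝒢.graph.Vertex) (H : Subgroup c.G), H ∈ ProfiniteSemiGraph.verticialSubgroups c v →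
      ∀ x x' : ∀ j, (tree j).Vertex,
      (∀ ⦃i j : J⦄ (h : i ≤ j), (trans h).vertexMap (x j) = x i) →
      (∀ ⦃i j : J⦄ (h : i ≤ j), (trans h).vertexMap (x' j) = x' i) →
      (∀ n ∈ H, ∀ j, (act j (ι n)).hom.vertexMap (x j) = x j) →
      (∀ n ∈ H, ∀ j, (act j (ι n)).hom.vertexMap (x' j) = x' j) → x = x')
    -- the GEOMETRIC pair dictionary for the restricted action (abc-iut-w4-d059's inputs of
    -- `edge_decompositionDataOfChart_of_ends` / `edgeFix_decompositionDataOfChart`, ArithEdgeStabilizer.lean)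
    (Adj : (∀ j, (tree j).Vertex) → (∀ j, (tree j).Vertex) → Prop)
    (hAdj : ∀ (x y : ∀ j, (tree j).Vertex) (g : Gtp), Adj x y →
      Adj (fun j => (act j g).hom.vertexMap (x j)) (fun j => (act j g).hom.vertexMap (y j)))
    (hAdjEnds : ∀ x y : ∀ j, (tree j).Vertex, Adj x y →
      ∃ (i : J) (ε : ∀ j : {j : J // i ≤ j}, (tree j.1).Edge)
        (c₁ c' : ∀ j : {j : J // i ≤ j}, (tree j.1).Branch),
        ∀ j, x j.1 ≠ y j.1 ∧ (tree j.1).edgeOf (c₁ j) = ε j ∧ (tree j.1).edgeOf (c' j) = ε j ∧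
          (tree j.1).abuts (c₁ j) = some (x j.1) ∧ (tree j.1).abuts (c' j) = some (y j.1))
    (hEndsAdj : ∀ x y : ∀ j, (tree j).Vertex,
      (∃ (i : J) (ε : ∀ j : {j : J // i ≤ j}, (tree j.1).Edge)
        (c₁ c' : ∀ j : {j : J // i ≤ j}, (tree j.1).Branch),
        ∀ j, x j.1 ≠ y j.1 ∧ (tree j.1).edgeOf (c₁ j) = ε j ∧ (tree j.1).edgeOf (c' j) = ε j ∧
          (tree j.1).abuts (c₁ j) = some (x j.1) ∧ (tree j.1).abuts (c' j) = some (y j.1)) → Adj x y)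
    (hEstabN : ∀ x y : ∀ j, (tree j).Vertex,
      (∀ ⦃i j : J⦄ (h : i ≤ j), (trans h).vertexMap (x j) = x i) →
      (∀ ⦃i j : J⦄ (h : i ≤ j), (trans h).vertexMap (y j) = y i) → Adj x y →
      ∃ (e : 𝒢.graph.Edge) (K : Subgroup c.G), K ∈ ProfiniteSemiGraph.edgeLikeSubgroups c e ∧
        ∀ n : c.G, n ∈ K ↔ (∀ j, (act j (ι n)).hom.vertexMap (x j) = x j) ∧
          ∀ j, (act j (ι n)).hom.vertexMap (y j) = y j)
    (hErigid : ∀ (v : 𝒢.graph.Vertex) (H : Subgroup c.G), H ∈ ProfiniteSemiGraph.verticialSubgroups c v →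
      ∀ (e e' : 𝒢.graph.Edge) (K K' : Subgroup c.G), K ∈ ProfiniteSemiGraph.edgeLikeSubgroups c e →
        K' ∈ ProfiniteSemiGraph.edgeLikeSubgroups c e' → K ≤ H → K' ≤ H →
        Subgroup.Commensurable K K' → K = K')
    (hEinj : ∀ x y y' : ∀ j, (tree j).Vertex,
      (∀ ⦃i j : J⦄ (h : i ≤ j), (trans h).vertexMap (x j) = x i) →
      (∀ ⦃i j : J⦄ (h : i ≤ j), (trans h).vertexMap (y j) = y i) →
      (∀ ⦃i j : J⦄ (h : i ≤ j), (trans h).vertexMap (y' j) = y' i) → Adj x y → Adj x y' →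
      (∀ n : c.G, ((∀ j, (act j (ι n)).hom.vertexMap (x j) = x j) ∧
          ∀ j, (act j (ι n)).hom.vertexMap (y j) = y j) ↔
        ((∀ j, (act j (ι n)).hom.vertexMap (x j) = x j) ∧
          ∀ j, (act j (ι n)).hom.vertexMap (y' j) = y' j)) → y = y')
    (X : 𝒢.graph.Vertex → ∀ j, (tree j).Vertex) (Y : 𝒢.graph.Branch → ∀ j, (tree j).Vertex)
    (hX : ∀ v, (∀ ⦃i j : J⦄ (h : i ≤ j), (trans h).vertexMap (X v j) = X v i) ∧
      ∀ n : c.G, n ∈ R.Hv v ↔ ∀ j, (act j (ι n)).hom.vertexMap (X v j) = X v j)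
    (hY : ∀ (b : 𝒢.graph.Branch) (v : 𝒢.graph.Vertex), 𝒢.graph.abuts b = some v →
      (∀ ⦃i j : J⦄ (h : i ≤ j), (trans h).vertexMap (Y b j) = Y b i) ∧ Adj (X v) (Y b) ∧
      ∀ n : c.G, n ∈ R.Hb b ↔ (∀ j, (act j (ι n)).hom.vertexMap (X v j) = X v j) ∧
        ∀ j, (act j (ι n)).hom.vertexMap (Y b j) = Y b j)
    (hEtrans : ∀ x₁ x₂ : ∀ j, (tree j).Vertex,
      (∀ ⦃i j : J⦄ (h : i ≤ j), (trans h).vertexMap (x₁ j) = x₁ i) →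
      (∀ ⦃i j : J⦄ (h : i ≤ j), (trans h).vertexMap (x₂ j) = x₂ i) → Adj x₁ x₂ →
      ∃ (b : 𝒢.graph.Branch) (v : 𝒢.graph.Vertex) (_ : 𝒢.graph.abuts b = some v) (n : c.G),
        ((fun j => (act j (ι n)).hom.vertexMap (X v j)) = x₁ ∧
            (fun j => (act j (ι n)).hom.vertexMap (Y b j)) = x₂) ∨
          ((fun j => (act j (ι n)).hom.vertexMap (X v j)) = x₂ ∧
            (fun j => (act j (ι n)).hom.vertexMap (Y b j)) = x₁))
    -- the ONE honest combinatorial binder (abc-iut-w4-d059's next deliverable): an eventual compatible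
    -- system of tree edges carries compatible end-point data
    (hEnds : ∀ (j₁ : J) (ε : ∀ j : {j : J // j₁ ≤ j}, (tree j.1).Edge),
      (∀ ⦃i j : {j : J // j₁ ≤ j}⦄ (h : i.1 ≤ j.1), (trans h).edgeMap (ε j) = ε i) →
      ∃ (c₁ c' : ∀ j : {j : J // j₁ ≤ j}, (tree j.1).Branch) (x₁ x₂ : ∀ j, (tree j).Vertex),
        (∀ ⦃i' j : J⦄ (h : i' ≤ j), (trans h).vertexMap (x₁ j) = x₁ i') ∧
        (∀ ⦃i' j : J⦄ (h : i' ≤ j), (trans h).vertexMap (x₂ j) = x₂ i') ∧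
        ∀ j, x₁ j.1 ≠ x₂ j.1 ∧ (tree j.1).edgeOf (c₁ j) = ε j ∧ (tree j.1).edgeOf (c' j) = ε j ∧
          (tree j.1).abuts (c₁ j) = some (x₁ j.1) ∧ (tree j.1).abuts (c' j) = some (x₂ j.1))
    -- finite levels (abc-iut-L3-d4's arithLevelAct etc.)
    (level : J → SemiGraph.{u}) [finiteVertex : ∀ j, Finite (level j).Vertex]
    [finiteBranch : ∀ j, Finite (level j).Branch]
    (quot : ∀ j, tree j ⟶ level j) (quot_isImmersion : ∀ j, SemiGraph.IsImmersion (quot j))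
    (levelAct : ∀ j, Gtp →* Aut (level j))
    (act_quot : ∀ (j : J) (g : Gtp), (act j g).hom ≫ quot j = quot j ≫ (levelAct j g).hom)
    (levelTrans : ∀ ⦃i j : J⦄, i ≤ j → (level j ⟶ level i))
    (levelTrans_id : ∀ j, levelTrans (le_refl j) = 𝟙 (level j))
    (levelTrans_comp : ∀ ⦃i j k : J⦄ (hij : i ≤ j) (hjk : j ≤ k),
      levelTrans hjk ≫ levelTrans hij = levelTrans (hij.trans hjk))
    (levelTrans_act : ∀ ⦃i j : J⦄ (h : i ≤ j) (g : Gtp),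
      (levelAct j g).hom ≫ levelTrans h = levelTrans h ≫ (levelAct i g).hom)
    (trans_quot : ∀ ⦃i j : J⦄ (h : i ≤ j), trans h ≫ quot i = quot j ≫ levelTrans h)
    (stabBranchPair : ∀ (j₀ : J) (w : ∀ i : {i : J // j₀ ≤ i}, (level i.1).Vertex)
      (β β' : ∀ i : {i : J // j₀ ≤ i}, (level i.1).Branch),
      (∀ i, β i ≠ β' i ∧ (level i.1).abuts (β i) = some (w i) ∧ (level i.1).abuts (β' i) = some (w i)) →
      (∀ ⦃i i' : {i : J // j₀ ≤ i}⦄ (h : i.1 ≤ i'.1), (levelTrans h).vertexMap (w i') = w i ∧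
        (levelTrans h).branchMap (β i') = β i ∧ (levelTrans h).branchMap (β' i') = β' i) →
      ∃ (v : 𝒢.graph.Vertex) (b b' : 𝒢.graph.Branch) (x h : Gtp),
        (ProfiniteSemiGraph.decompositionDataOfChart R ι).abut b = some v ∧ (ProfiniteSemiGraph.decompositionDataOfChart R ι).abut b' = some v ∧
        h ∈ (ProfiniteSemiGraph.decompositionDataOfChart R ι).vertGp v ∧ (b' ≠ b ∨ h ∉ (ProfiniteSemiGraph.decompositionDataOfChart R ι).brGp b) ∧
        ∀ g : Gtp, (∀ i, (levelAct i.1 g).hom.vertexMap (w i) = w i ∧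
          (levelAct i.1 g).hom.branchMap (β i) = β i ∧ (levelAct i.1 g).hom.branchMap (β' i) = β' i) →
          g ∈ conjSubgroup x ((ProfiniteSemiGraph.decompositionDataOfChart R ι).brGp b ⊓
            conjSubgroup h ((ProfiniteSemiGraph.decompositionDataOfChart R ι).brGp b'))) :
    ArithLevelData 𝒢.graph (ProfiniteSemiGraph.decompositionDataOfChart R ι) aug baseAct where
  J := J
  tree := tree
  isTree := isTree
  vertex := vertex
  proj := proj
  act := act
  isOpen_ker := isOpen_ker
  act_proj := act_proj
  noSwitchBase := noSwitchBase
  trans := trans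
  trans_id := trans_id
  trans_comp := trans_comp
  trans_over := trans_over
  trans_act := trans_act
  fix := ProfiniteSemiGraph.fix_decompositionDataOfChart ι tree act trans h𝒢 R hι hnorm
    (fun i j h g y => by
      have := congrArg (fun φ => SemiGraph.Hom.vertexMap φ y) (trans_act h g)
      simpa only [SemiGraph.comp_vertexMap, Function.comp_apply] using this)
    hfixN hstabN huniqN
  stab := ProfiniteSemiGraph.stab_decompositionDataOfChart ι tree act trans h𝒢 R hι hnorm
    (fun i j h g y => by
      have := congrArg (fun φ => SemiGraph.Hom.vertexMap φ y) (trans_act h g)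
      simpa only [SemiGraph.comp_vertexMap, Function.comp_apply] using this)
    hstabN huniqN
  edge := fun j₁ ε hε => by
    obtain ⟨c₁, c', x₁, x₂, hx₁, hx₂, hends⟩ := hEnds j₁ ε hε
    exact ProfiniteSemiGraph.edge_decompositionDataOfChart_of_ends ι tree act trans h𝒢 R hι hnorm isTree
      (fun i j h g y => by
        have := congrArg (fun φ => SemiGraph.Hom.vertexMap φ y) (trans_act h g)
        simpa only [SemiGraph.comp_vertexMap, Function.comp_apply] using this)
      hstabN huniqN Adj hAdj hEndsAdj hEstabN hErigid hEinj X Y hX hY hEtrans ε c₁ c' x₁ x₂ hx₁ hx₂ hends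
  edgeFix := ProfiniteSemiGraph.edgeFix_decompositionDataOfChart ι tree act trans h𝒢 hG R hι hnorm isTree
    (fun i j h g y => by
      have := congrArg (fun φ => SemiGraph.Hom.vertexMap φ y) (trans_act h g)
      simpa only [SemiGraph.comp_vertexMap, Function.comp_apply] using this)
    hstabN huniqN Adj hAdj hAdjEnds hEstabN hErigid hEinj X Y hX hY
  level := level
  quot := quot
  quot_isImmersion := quot_isImmersion
  levelAct := levelAct
  act_quot := act_quot
  levelTrans := levelTrans
  levelTrans_id := levelTrans_id
  levelTrans_comp := levelTrans_comp
  levelTrans_act := levelTrans_act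
  trans_quot := trans_quot
  stabBranchPair := stabBranchPair

end ProfiniteSemiGraph

end Literature.AnabelianGeometry.SemiGraphs
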